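import Summits.Langlands.Langlands.Theorems.PhantomRMYoshidaResiduallyYoshidaLiftingRibetRealisation
import Literature.NumberTheory.GaloisRepresentations.GaloisRep
import Mathlib.NumberTheory.Padics.Complex
import HarnessLib

/-!
# The realised cocycle IS a 1-cocycle (stub `stub_realisedCocycleIdentity`) — line `sector-klingen-split`, crux `ResiduallyYoshidaLifting`

Lead prover-line-stmt-Langlands-13639-c3-0 (cycle 3, 2026-08-17), skeleton rev 6.  The anchor / propagation stubs of the line quantify over
matrix-valued functions `B : Γ_ℚ → M₂(k)` REALISED by an integral frame `rint` (a homomorphism) with reduction `h (σ g, B g; 0, σ' g) h⁻¹`.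
This file records the bridge to group cohomology: such a `B` satisfies the 1-COCYCLE identity for `Hom(σ̄', σ̄)`,
`B (g g') = σ g · B g' + B g · σ' g'` (multiplicativity of the reduction, block `(1,2)` of the product of two block upper-triangular
matrices), so "`B` is not a coboundary `σ X - X σ'`" is exactly "`[B] ≠ 0` in `H¹(Γ_ℚ, Hom(σ̄', σ̄))`", and the cyclicity hypothesis of
`stub_selmerAnchorKlingen_of_cyclic` (p148691) is implied by `dim_k H¹ = 1` on the realisable classes.
-/

noncomputable section

open scoped MatrixGroups

set_option linter.dupNamespace false
set_option autoImplicit false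

namespace Summit.Langlands.Langlands.Cruxes.ResiduallyYoshidaLifting.SectorKlingenSplit.Ribet

/-- Block `(1,2)` of a product of block upper-triangular matrices. [folklore] -/
theorem fromBlocks_upper_mul_toBlocks₁₂ {k : Type*} [CommRing k] {m : Type*} [Fintype m]
    (S₁ B₁ S₁' S₂ B₂ S₂' : Matrix m m k) :
    (Matrix.fromBlocks S₁ B₁ 0 S₁' * Matrix.fromBlocks S₂ B₂ 0 S₂').toBlocks₁₂ = S₁ * B₂ + B₁ * S₂' := by
  rw [Matrix.fromBlocks_multiply, Matrix.toBlocks_fromBlocks₁₂]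

/-- **Registered statement `stub_realisedCocycleIdentity`**: a residual cocycle realised by an integral frame (a homomorphism `rint`
with reduction `h (σ, B; 0, σ') h⁻¹`) satisfies the 1-cocycle identity `B (g * g') = σ g * B g' + B g * σ' g'`. [folklore] -/
theorem stub_realisedCocycleIdentity :
    ∀ (p : ℕ) [Fact p.Prime] (k : Type) [Field k] [TopologicalSpace k] [DiscreteTopology k]
      (red : Valued.integer (PadicAlgCl p) →+* k)
      (σ σ' : Literature.NumberTheory.GaloisRepresentations.FramedGaloisRep ℚ k 2)
      (rint : Field.absoluteGaloisGroup ℚ →* GL (Fin 4) (Valued.integer (PadicAlgCl p)))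
      (h : GL (Fin 4) k) (B : Field.absoluteGaloisGroup ℚ → Matrix (Fin 2) (Fin 2) k),
      (∀ g, (Matrix.GeneralLinearGroup.map red (rint g)).val =
        h.val * Matrix.reindex finSumFinEquiv finSumFinEquiv (Matrix.fromBlocks (σ g).val (B g) 0 (σ' g).val) * (h⁻¹).val) →
      ∀ g g', B (g * g') = (σ g).val * B g' + B g * (σ' g').val := by
  intro p _ k _ _ _ red σ σ' rint h B hred g g'
  -- the block forms multiply like `rint`
  have hconj : ∀ x, Matrix.reindex finSumFinEquiv finSumFinEquiv (Matrix.fromBlocks (σ x).val (B x) 0 (σ' x).val) =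
      (h⁻¹).val * (Matrix.GeneralLinearGroup.map red (rint x)).val * h.val := by
    intro x
    rw [hred x]
    simp only [Matrix.mul_assoc, Units.inv_mul_cancel_left, Units.inv_mul, Matrix.mul_one]
  have hmul : Matrix.reindex finSumFinEquiv finSumFinEquiv (Matrix.fromBlocks (σ (g * g')).val (B (g * g')) 0 (σ' (g * g')).val) =
      Matrix.reindex finSumFinEquiv finSumFinEquiv (Matrix.fromBlocks (σ g).val (B g) 0 (σ' g).val) *
        Matrix.reindex finSumFinEquiv finSumFinEquiv (Matrix.fromBlocks (σ g').val (B g') 0 (σ' g').val) := by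
    rw [hconj, hconj, hconj, map_mul, map_mul, Units.val_mul]
    simp only [Matrix.mul_assoc, Units.mul_inv_cancel_left]
  have hF2 : Matrix.fromBlocks (σ (g * g')).val (B (g * g')) 0 (σ' (g * g')).val =
      Matrix.fromBlocks (σ g).val (B g) 0 (σ' g).val * Matrix.fromBlocks (σ g').val (B g') 0 (σ' g').val := by
    apply (Matrix.reindex (finSumFinEquiv : Fin 2 ⊕ Fin 2 ≃ Fin (2 + 2)) (finSumFinEquiv : Fin 2 ⊕ Fin 2 ≃ Fin (2 + 2))).injective
    rw [hmul, reindex_mul_reindex]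
  -- read off block `(1,2)`
  have h12 := congrArg Matrix.toBlocks₁₂ hF2
  rw [Matrix.toBlocks_fromBlocks₁₂, fromBlocks_upper_mul_toBlocks₁₂] at h12
  exact h12

/-- Consequence: `B 1 = 0` for a realised cocycle. [folklore] -/
theorem realisedCocycle_map_one {p : ℕ} [Fact p.Prime] {k : Type} [Field k] [TopologicalSpace k] [DiscreteTopology k]
    (red : Valued.integer (PadicAlgCl p) →+* k)
    (σ σ' : Literature.NumberTheory.GaloisRepresentations.FramedGaloisRep ℚ k 2)
    (rint : Field.absoluteGaloisGroup ℚ →* GL (Fin 4) (Valued.integer (PadicAlgCl p)))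
    (h : GL (Fin 4) k) (B : Field.absoluteGaloisGroup ℚ → Matrix (Fin 2) (Fin 2) k)
    (hred : ∀ g, (Matrix.GeneralLinearGroup.map red (rint g)).val =
      h.val * Matrix.reindex finSumFinEquiv finSumFinEquiv (Matrix.fromBlocks (σ g).val (B g) 0 (σ' g).val) * (h⁻¹).val) :
    B 1 = 0 := by
  have h11 := stub_realisedCocycleIdentity p k red σ σ' rint h B hred 1 1
  rw [mul_one, map_one, map_one, Units.val_one, Matrix.one_mul, Matrix.mul_one] at h11
  -- h11 : B 1 = B 1 + B 1
  have : B 1 + B 1 = B 1 + 0 := by rw [add_zero]; exact h11.symm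
  exact add_left_cancel this

end Summit.Langlands.Langlands.Cruxes.ResiduallyYoshidaLifting.SectorKlingenSplit.Ribet

end
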